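import Mathlib
import Summits.Ventures.HodgeRepro0.P8K3LatticeCDefs
import Summits.Ventures.HodgeRepro0.P8K3LatticeC7
import Summits.Ventures.HodgeRepro0.P8K3LatticeC8

/-!
# P8K3LatticeCIso (seat p8) — the discriminant form of the family-(C) lattice has exactly 9 isotropic non-zero elements (= u(2) ⊕ u(2))

With `w₁..w₄` the columns of `W` (the columns of `Q` at the four non-unit diagonal positions), `Gm * (w_i/2)` is integral (`GW` has even
entries), so `w_i/2 ∈ L^*` and their classes generate `L^*/L ≅ (ℤ/2)⁴`. The discriminant form is `q(Σ a_i w_i/2) = N(a)/4 ∈ ℚ/2ℤ` with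
`N(a) = aᵀ Gram4 a`, `Gram4 = Wᵀ Gm W`; it vanishes iff `8 ∣ N(a)`. Among the 15 non-zero `a ∈ (ℤ/2)⁴` exactly 9 are isotropic — the
count of `u(2) ⊕ u(2)` (each `u(2)` has two isotropic and one non-isotropic non-zero element: 3·1 + 1·3 = 6 non-isotropic), which
together with the determinant identifies the 2-elementary lattice (paper side: `T(Ỹ_(C)) ≅ U(2) ⊕ U(2)`).
-/

namespace HodgeRepro0.P8K3LatticeC

/-- The integer quadratic form `(Σ a_i w_i)ᵀ Gm (Σ a_i w_i)` in terms of `Gram4`. -/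
def N (a : Fin 4 → ℤ) : ℤ := ∑ i, ∑ j, a i * Gram4 i j * a j

/-- `Gram4 = Wᵀ * GL * W`. -/
theorem Gram4_eq : Gram4 = W.transpose * Gm * W := by
  rw [← Wt_eq, Matrix.mul_assoc, Gm_mul_W, Wt_mul_GW]

/-- The 16 vectors of `(ℤ/2)⁴` as integer 0/1 vectors. -/
def vecs : List (Fin 4 → ℤ) :=
  (List.finRange 16).map fun k => ![((k : ℕ) / 8 % 2 : ℕ), ((k : ℕ) / 4 % 2 : ℕ), ((k : ℕ) / 2 % 2 : ℕ), ((k : ℕ) % 2 : ℕ)]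

/-- Exactly 9 of the 15 non-zero elements of the discriminant group are isotropic (`8 ∣ N a`), and the zero vector is. -/
theorem iso_count : (vecs.filter (fun a => N a % 8 = 0)).length = 10 := by
  decide

end HodgeRepro0.P8K3LatticeC
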